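import Literature.AnabelianGeometry.AbsoluteAnabelian.FundamentalExtension
import Literature.AnabelianGeometry.AbsoluteAnabelian.SubpadicFiniteExtension
import HarnessLib

/-!
# Examples of sub-`p`-adic fields: `ℚ_p`, MLF's, number fields ([pGC] Def 15.4 (i), examples (1)–(2))

Proof-only companion to `AbsTopIII/KummerFaithful.lean` (`AbsTopIII.IsSubpadicFor`) and
`FundamentalExtension.lean` (`IsMLF`, `IsNF`): [pGC] p. 77, "the following are all examples of
sub-`p`-adic fields: (1) finitely generated (in particular, finite) extensions of `ℚ_p`; (2) number
fields".  In particular an MLF is sub-`p`-adic — the tacit step by which [AbsTopIII] Cor 1.10 (iii)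
p. 43 ("`X` of strictly Belyi type [so that we are in the situation of Theorem 1.9]") applies Thm 1.9
(stated over sub-`p`-adic fields) to curves over MLF's (chain audit `plan/L4/LC1-CHAIN.md`, links
L3c/L3d).  No new definitions. [cite: MochizukiLocAn1999, Def 15.4 (i) p.77]
-/

universe u

namespace Literature.AnabelianGeometry.AbsoluteAnabelian.AbsTopIII

/-- `ℚ_p` is sub-`p`-adic ([pGC] Def 15.4 (i), example (1) p. 77).
[cite: MochizukiLocAn1999, Def 15.4 (i) p.77] -/
theorem IsSubpadicFor.padic (p : ℕ) [Fact p.Prime] : IsSubpadicFor ℚ_[p] p :=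
  ⟨⟨ℚ_[p], inferInstance, inferInstance,
    IntermediateField.fg_top_iff.mpr inferInstance, ⟨RingHom.id _⟩⟩⟩

/-- A field receiving a ring homomorphism of finite degree from `ℚ_p` — in particular an MLF in the
sense of [AbsTopI] §0 — is sub-`p`-adic ([pGC] Def 15.4 (i), example (1) p. 77: "finitely generated
(in particular, finite) extensions of `ℚ_p`"). [cite: MochizukiLocAn1999, Def 15.4 (i) p.77] -/
theorem IsSubpadicFor.of_finite_padic {K : Type u} [Field K] (p : ℕ) [Fact p.Prime]
    (f : ℚ_[p] →+* K) (hf : @Module.Finite ℚ_[p] K _ _ f.toAlgebra.toModule) : IsSubpadicFor K p := by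
  letI : Algebra ℚ_[p] K := f.toAlgebra
  haveI : Module.Finite ℚ_[p] K := hf
  exact (IsSubpadicFor.padic p).of_finite

/-- An MLF ([AbsTopI] §0 p. 7: a finite extension of some `ℚ_p`; the cell's `IsMLF`) is sub-`p`-adic
for its residue characteristic `p`, hence sub-`p`-adic ([pGC] Def 15.4 (i) example (1) p. 77).  This
is what lets [AbsTopIII] Cor 1.10 (iii) p. 43 invoke Thm 1.9 (stated over sub-`p`-adic fields) for
curves over an MLF. [cite: MochizukiLocAn1999, Def 15.4 (i) p.77] -/
theorem IsSubpadic.of_isMLF {K : Type u} [Field K] (h : IsMLF K) : IsSubpadic K := by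
  obtain ⟨p, hp, f, hf⟩ := h.exists_padic
  exact ⟨⟨p, hp, IsSubpadicFor.of_finite_padic p f hf⟩⟩

/-- A number field is sub-`p`-adic for EVERY prime `p` ([pGC] Def 15.4 (i), example (2) p. 77:
"number fields (i.e., finite extensions of `ℚ`)") — via an embedding into a finite extension of `ℚ_p`
inside `ℚ̄_p`. [cite: MochizukiLocAn1999, Def 15.4 (i) p.77] -/
theorem IsSubpadicFor.of_numberField (K : Type u) [Field K] [NumberField K] (p : ℕ) [Fact p.Prime] :
    IsSubpadicFor K p := by
  -- `ℚ ↪ ℚ_p` is (trivially) an embedding into a finitely generated extension of `ℚ_p`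
  have hQ : ∃ (L : Type) (_ : Field L) (_ : Algebra ℚ_[p] L),
      (⊤ : IntermediateField ℚ_[p] L).FG ∧ Nonempty (ℚ →+* L) :=
    ⟨ℚ_[p], inferInstance, inferInstance, IntermediateField.fg_top_iff.mpr inferInstance,
      ⟨algebraMap ℚ ℚ_[p]⟩⟩
  exact ⟨exists_fg_extension_of_finite (k := ℚ) (F := K) hQ⟩

/-- A number field (the cell's `IsNF`) is sub-`p`-adic ([pGC] Def 15.4 (i), example (2) p. 77).
[cite: MochizukiLocAn1999, Def 15.4 (i) p.77] -/
theorem IsSubpadic.of_isNF {K : Type u} [Field K] (h : IsNF K) : IsSubpadic K := by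
  haveI : NumberField K := h.numberField
  haveI : Fact (Nat.Prime 2) := ⟨Nat.prime_two⟩
  exact ⟨⟨2, inferInstance, IsSubpadicFor.of_numberField K 2⟩⟩

end Literature.AnabelianGeometry.AbsoluteAnabelian.AbsTopIII
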